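import Literature.MathematicalPhysics.QuantumFieldTheory.Balaban1983to89.B9Eq3130HessianSlotPerturbationDiagonal
import Literature.MathematicalPhysics.QuantumFieldTheory.Balaban1983to89.B9Eq3120DeltaPiPrimeFormDiagonalClosed

/-!
# `Balaban1983to89.B9Thm311LaplaceAkPiPositiveDiagonal` — T. Bałaban, *Propagators for lattice gauge theories in a background field*, Commun. Math. Phys. **99**
# (1985) 389–434 [Balaban1985BackgroundPropagators] Thm 3.11 p. 416 with (3.122) p. 420, (3.130) p. 421, (3.120) p. 419, AT `k = n+1` AVERAGING LEVELS ON PRINT's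
# DIAGONAL `ηL^{n+1} = 1`: **PRINT's OPERATOR `Δ̃_{a,k}(U) = π_k†Δ^η(U)π_k + D_UR_kD*_U + Q_k*aQ_k` (3.122) (`B9Eq3119DeltaPiTower.laplaceAkPi`, NAMED) IS STRONGLY
# COERCIVE IN THE FLAT ENERGY NORM AND POSITIVE DEFINITE — `∃ α₀ γ` BEFORE EVERY BINDER, THE θ-LETTER INHABITED** (Thm 3.11's positivity clause for the
# operator whose inverse is print's `G̃` of (3.126)∕(3.130); the `hpos₁`-witness of the owner's π-junction and of the Support re-instantiation at `laplaceAkPi`)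

statement-level skeleton of published theorems with citation tags; proofs where landed; nothing here is a claim about the Yang–Mills mass gap

CITATION HEADER (lean-in-tree rule).  Audit cell `pub-balaban`, sub-cell `t4`, BINDER row NE9; filed by the row OWNER lineage `b2b-balaban-t4-ne9-p1`
(gen 88, plan v8; the π-analogue of `B9Thm311LaplaceAkPositiveDiagonal.exists_laplaceAk_pos_diagonal_closed`).  Sources READ first-hand by this lineage in
the held text layer [Balaban1985BackgroundPropagators] (`paper:balaban1985-cmp99-background-propagators`, journal page = PDF page + 388) pp. 416, 419–421.

THE PRINT (verbatim, text layer).  p. 416: *«Theorem 3.11. Under the assumptions of the Theorems 3.1–3.10 (i.e. for M sufficiently large and α₀ sufficiently small) the operators Δ′_a, G′, (Q′G′²Q′*)⁻¹, Δ_a, G are positive definite.»*; p. 420: *«… we will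
prove that this term [Δ′_π] is a small perturbation of Δ_a, and that the operator G̃ used in the above formula has all the properties formulated in Theorems
3.3, 3.10»*; p. 421: *«G̃ = G₀(I − Δ′_πG₀)⁻¹ (3.130)»*.

WHY THIS FILE (cell context).  The owner's `B9Eq3130HessianSlotPerturbationDiagonal` proves (a) strong coercivity `γ₁∕2` and (b) positive definiteness of
`Δ̃ = Δ₁ + D_UR_kD*_U + Q_k*aQ_k` for ANY slot `Δ₁` with `N₁`-form defect `θ ≤ γ₁∕2`; ne9-leaf-02's `B9Eq3120DeltaPiPrimeFormDiagonalClosed` inhabits the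
θ-letter `θ = θ̄·α` for print's slot `Δ₁ := π_k†Δ^η(U)π_k`.  Every file of the Δ_π port (the π-junction `B9Eq3126EnergyBallTowerPiClosed`, its (117)-readings,
ne9-leaf-03's two-window files) carries the positivity of `laplaceAkPi` as a DISPLAYED witness `hpos₁` «inhabited on the class».  THIS file is that
inhabitant BY NAME, `∃ α₀ γ` first — the supplier of the `∃ hpos` clause of the `Support/NE9CurChartTower*` re-instantiation at `laplaceAkPi` (INTERFACE
REQUEST NE9) exactly as `B9Thm311LaplaceAkPositiveDiagonal` supplies the chain's.

WHAT IS PROVED (sorry-free; 0 `def`; [folklore] composition BY NAME + threshold arithmetic; nothing of [B9] asserted as printed).  Binders: E162's per-level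
data, `hRS`, `U(b) ∈ U1`, the windows `‖U(b) − 1‖ ≤ αη`, `‖U(∂p) − 1‖ ≤ αη²`, `ε_j ≤ αr^j`, `|η|^d∕c₀ ≤ ρ_w`, the averaged-bond membership `U^{(j)}(b) ∈ U1`,
ANY site witness `hpos′` (positivity of `Δ′_{a′,k}(U)`, the letter `G′_k` of `π_k`).
* **`exists_laplaceAkPi_coercive_diagonal_closed`** — `∃ α₀ γ > 0` before every binder; then for all `x`:
  `γ·(‖curl₁x‖² + ‖div₁x‖² + ‖x‖²) ≤ re⟨x, laplaceAkPi L m n φ τ η U a′ hpos′ hL αU hα1 hU1 hreg a x⟩` (`γ = γ₁∕2` of the slot file at `θ̄α ≤ γ₁∕2`).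
* **`exists_laplaceAkPi_pos_diagonal_closed`** — `∃ α₀ > 0` before every binder; then `0 < re⟨x, laplaceAkPi … x⟩` for `x ≠ 0` — the `hpos₁` WITNESS.
HONEST SCOPE.  Energy currency on the diagonal ONLY; the θ-letter is CONSUMED (leaf-02), not re-proved; the small-field WINDOWS, `hRS`, `C_τ`, `ρ_w`, the
averaged-bond membership and `hpos′` stay HYPOTHESES; crude constants.  NOT summit progress (cell pub-balaban: NE9 NOT PRINTED ∕ NOT PROVED; «NE9 ⇐ the named
binders»; row WALLED ON A MODEL (O-NE9-1; #5 UNRULED); spine PROVED 0∕9; rung (B)+1 finite T⁴ — NOT infinite volume, NOT mass gap, NOT BetaPertH, NOT Clay).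
HONEST DEPENDENCY (cell line): continuum YM on T⁴ ⇐ BetaPertH ∧ nine spine estimates (0/9 proved); BetaPertH ⇐ (D1) ∧ (D4) ∧ CAP+tail; G-an2-4 gates asym,
D1 and NE2/3/4.  NEW file; nothing modified.  Net new unproved facts: 0.
-/

noncomputable section

open scoped InnerProductSpace ComplexConjugate BigOperators

namespace Literature.MathematicalPhysics.QuantumFieldTheory.Balaban1983to89.B9Thm311LaplaceAkPiPositiveDiagonal

open B4Sect5Torus (TSite)
open B9SectCLatticeCarrier (Bond)
open B11Eq103H1Complex (SiteL2K BondL2K covDerivL2K covDivL2K laplaceALatticeK)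
open B9Eq310HessianOperator (adTransportW hessOp covCurlL2K)
open B9Eq310DeltaPrime (plaqHolU)
open B9Eq315QTorus (perCfg cornerSite)
open B9Eq315QTower (towerP UlevOf)
open B9Eq326OperatorTower (QkW RofUk)
open B9Eq324DeltaPrimeATower (laplacePrimeAk GpOfUk)
open B9Eq3119DeltaPiTower (piOfUk laplaceAkPi)
open B7Prop1Explicit (U1 Wcx boxVec)
open B9Eq3130HessianSlotPerturbationDiagonal (exists_hessian_slot_perturbation_diagonal)
open B9Eq3120DeltaPiPrimeFormDiagonalClosed (exists_form_defect_piOfUk_diagonal_closed)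

variable {d : ℕ} (L : ℕ) [NeZero L] (hL : 1 ≤ L)
  {𝔸 : Type*} [NormedRing 𝔸] [NormedAlgebra ℂ 𝔸] [CompleteSpace 𝔸] [NormOneClass 𝔸] [StarRing 𝔸] [NormedStarGroup 𝔸] [StarModule ℂ 𝔸]
  {W : Type*} [NormedAddCommGroup W] [InnerProductSpace ℂ W] [FiniteDimensional ℂ W] (φ : W ≃ₗ[ℂ] 𝔸)
  {Mφ Mφ' : ℝ} (hMφ : 0 ≤ Mφ) (hMφ' : 0 ≤ Mφ') (hφ : ∀ w, ‖φ w‖ ≤ Mφ * ‖w‖) (hφ' : ∀ X, ‖φ.symm X‖ ≤ Mφ' * ‖X‖)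
  {a : ℝ} (ha : 0 < a) {a' : ℝ} (ha' : 0 < a') {r : ℝ} (hr0 : 0 ≤ r) (hr1 : r < 1)
  (τ : 𝔸 →ₗ[ℂ] ℂ) {Cτ : ℝ} (hτ : ∀ X, ‖τ X‖ ≤ Cτ * ‖X‖) (hCτ : 0 ≤ Cτ) {ρw : ℝ} (hρw : 0 ≤ ρw)

include hMφ hMφ' hφ hφ' ha ha' hr0 hr1 hτ hCτ hρw

-- deep definitional unfolding `laplaceAkPi` ↦ `laplaceALatticeK … (π†Δπ) …`
set_option maxRecDepth 8192 in
/-- **PRINT's `Δ̃_{a,k}(U)` IS STRONGLY COERCIVE IN THE FLAT ENERGY NORM ON THE DIAGONAL** — `∃ α₀ γ > 0` before every binder; then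
`γ·(‖curl₁x‖² + ‖div₁x‖² + ‖x‖²) ≤ re⟨x, laplaceAkPi … x⟩` for all `x`: `B9Eq3130HessianSlotPerturbationDiagonal` (a) at print's slot with the θ-letter
`θ̄α ≤ γ₁∕2` (`B9Eq3120DeltaPiPrimeFormDiagonalClosed`). [folklore] [cite: Balaban1985BackgroundPropagators, Thm 3.11 p.416, (3.122) p.420, (3.130) p.421] -/
theorem exists_laplaceAkPi_coercive_diagonal_closed :
    ∃ α₀ γ : ℝ, 0 < α₀ ∧ 0 < γ ∧ ∀ (n : ℕ) (η : ℝ), η * (L : ℝ) ^ (n + 1) = 1 →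
      ∀ (c₀ c₁ : ℝ) [Fact (0 < c₀)] [Fact (0 < c₁)], c₀ * ((L : ℝ) ^ (n + 1)) ^ d = c₁ → |η| ^ d / c₀ ≤ ρw →
      ∀ (m : Fin d → ℕ) [∀ i, NeZero (m i)] (U : Bond d (towerP L m (n + 1)) → 𝔸ˣ) (αU : ℕ → ℝ) (hα1 : ∀ j, αU j ≤ 1 / 64)
        (hU1 : ∀ (j : ℕ) (x : B7Prop1Explicit.Site d) (κ : Fin d), perCfg (towerP L m (j + 1)) (UlevOf L m (n + 1) U j) x κ ∈ U1 𝔸)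
        (hreg : ∀ (j : ℕ) (y : TSite d (towerP L m j)) (κ : Fin d) (r : Fin d → Fin L),
          ‖((Wcx L (perCfg (towerP L m (j + 1)) (UlevOf L m (n + 1) U j)) (cornerSite L y) κ (boxVec L r) : 𝔸ˣ) : 𝔸) - 1‖ ≤ αU j)
        (εU : ℕ → ℝ), (∀ j, 0 ≤ εU j) → (∀ (j : ℕ) (b : Bond d (towerP L m (j + 1))), ‖(UlevOf L m (n + 1) U j b : 𝔸) - 1‖ ≤ εU j) →
      ∀ {α : ℝ}, 0 ≤ α → α ≤ α₀ →
        (∀ (b : Bond d (towerP L m (n + 1))) (v u : W), ⟪adTransportW φ U b v, u⟫_ℂ = ⟪v, adTransportW φ (fun b => (U b)⁻¹) b u⟫_ℂ) →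
        (∀ b, U b ∈ U1 𝔸) → (∀ b, ‖(U b : 𝔸) - 1‖ ≤ α * η) →
        (∀ p : B9SectCLatticeCarrier.Plaq d (towerP L m (n + 1)), ‖(plaqHolU U p : 𝔸) - 1‖ ≤ α * η ^ 2) →
        (∀ j < n + 1, εU j ≤ α * r ^ j) →
        (∀ (j : ℕ) (b : Bond d (towerP L m (j + 1))), UlevOf L m (n + 1) U j b ∈ U1 𝔸) →
        ∀ (hpos' : ∀ x : SiteL2K ℂ d (towerP L m (n + 1)) c₀ W, x ≠ 0 → 0 < RCLike.re ⟪x, laplacePrimeAk L m n φ η U a' (c₁ := c₁) x⟫_ℂ)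
          (x : BondL2K ℂ d (towerP L m (n + 1)) c₀ W),
          γ * (‖covCurlL2K ℂ c₀ ((η : ℂ))⁻¹ (adTransportW φ (fun _ : Bond d (towerP L m (n + 1)) => (1 : 𝔸ˣ))) x‖ ^ 2 +
              ‖covDivL2K ℂ c₀ ((η : ℂ))⁻¹ (adTransportW φ fun _ : Bond d (towerP L m (n + 1)) => (1 : 𝔸ˣ)⁻¹) x‖ ^ 2 + ‖x‖ ^ 2) ≤
            RCLike.re ⟪x, laplaceAkPi L m n φ τ η U a' hpos' hL αU hα1 hU1 hreg (c₁ := c₁) a x⟫_ℂ := by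
  obtain ⟨αθ, θb, hαθ, hθb, HΘ⟩ := exists_form_defect_piOfUk_diagonal_closed (d := d) L φ hMφ hMφ' hφ hφ' ha' hr0 hr1 τ hτ hCτ hρw
  obtain ⟨α5, γ5, hα5, hγ5, H5⟩ := exists_hessian_slot_perturbation_diagonal (d := d) L hL φ hMφ hMφ' hφ hφ' ha hr0 hr1 τ hτ hCτ hρw
  obtain ⟨αγ, hαγdef⟩ : ∃ αγ : ℝ, αγ = γ5 / (2 * θb) := ⟨_, rfl⟩
  have hαγ : 0 < αγ := by rw [hαγdef]; positivity
  refine ⟨min (min αθ α5) αγ, γ5 / 2, lt_min (lt_min hαθ hα5) hαγ, by positivity, ?_⟩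
  intro n η hηL c₀ c₁ _ _ hw hρ m _ U αU hα1 hU1 hreg εU hεU hUε α hα0 hαle hRS hUb hUη hpl hεg hUlev hpos' x
  have hαθ' : α ≤ αθ := hαle.trans ((min_le_left _ _).trans (min_le_left _ _))
  have hα5' : α ≤ α5 := hαle.trans ((min_le_left _ _).trans (min_le_right _ _))
  have hαγ' : α ≤ αγ := hαle.trans (min_le_right _ _)
  have hθ := HΘ n η hηL c₀ c₁ hw hρ m U hRS α hα0 hαθ' hUb hUη hpl εU hεU hεg hUε hUlev hpos'
  have hθ0 : 0 ≤ θb * α := mul_nonneg hθb.le hα0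
  have hθ5 : θb * α ≤ γ5 / 2 := by
    have h1 : θb * α ≤ θb * αγ := mul_le_mul_of_nonneg_left hαγ' hθb.le
    have h2 : θb * αγ = γ5 / 2 := by rw [hαγdef]; field_simp
    linarith
  exact (H5 n η hηL c₀ c₁ hw hρ m U αU hα1 hU1 hreg εU hεU hUε hα0 hα5' hRS hUb hUη hpl hεg _ hθ0 hθ5 hθ).1 x

-- deep definitional unfolding `laplaceAkPi` ↦ `laplaceALatticeK … (π†Δπ) …`
set_option maxRecDepth 8192 in
/-- **PRINT's `Δ̃_{a,k}(U)` IS POSITIVE DEFINITE ON THE DIAGONAL — THE `hpos₁`-WITNESS** — `∃ α₀ > 0` before every binder; then `0 < re⟨x, laplaceAkPi … x⟩`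
for `x ≠ 0` (from the strong coercivity). [folklore] [cite: Balaban1985BackgroundPropagators, Thm 3.11 p.416, (3.122) p.420, (3.130) p.421] -/
theorem exists_laplaceAkPi_pos_diagonal_closed :
    ∃ α₀ : ℝ, 0 < α₀ ∧ ∀ (n : ℕ) (η : ℝ), η * (L : ℝ) ^ (n + 1) = 1 →
      ∀ (c₀ c₁ : ℝ) [Fact (0 < c₀)] [Fact (0 < c₁)], c₀ * ((L : ℝ) ^ (n + 1)) ^ d = c₁ → |η| ^ d / c₀ ≤ ρw →
      ∀ (m : Fin d → ℕ) [∀ i, NeZero (m i)] (U : Bond d (towerP L m (n + 1)) → 𝔸ˣ) (αU : ℕ → ℝ) (hα1 : ∀ j, αU j ≤ 1 / 64)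
        (hU1 : ∀ (j : ℕ) (x : B7Prop1Explicit.Site d) (κ : Fin d), perCfg (towerP L m (j + 1)) (UlevOf L m (n + 1) U j) x κ ∈ U1 𝔸)
        (hreg : ∀ (j : ℕ) (y : TSite d (towerP L m j)) (κ : Fin d) (r : Fin d → Fin L),
          ‖((Wcx L (perCfg (towerP L m (j + 1)) (UlevOf L m (n + 1) U j)) (cornerSite L y) κ (boxVec L r) : 𝔸ˣ) : 𝔸) - 1‖ ≤ αU j)
        (εU : ℕ → ℝ), (∀ j, 0 ≤ εU j) → (∀ (j : ℕ) (b : Bond d (towerP L m (j + 1))), ‖(UlevOf L m (n + 1) U j b : 𝔸) - 1‖ ≤ εU j) →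
      ∀ {α : ℝ}, 0 ≤ α → α ≤ α₀ →
        (∀ (b : Bond d (towerP L m (n + 1))) (v u : W), ⟪adTransportW φ U b v, u⟫_ℂ = ⟪v, adTransportW φ (fun b => (U b)⁻¹) b u⟫_ℂ) →
        (∀ b, U b ∈ U1 𝔸) → (∀ b, ‖(U b : 𝔸) - 1‖ ≤ α * η) →
        (∀ p : B9SectCLatticeCarrier.Plaq d (towerP L m (n + 1)), ‖(plaqHolU U p : 𝔸) - 1‖ ≤ α * η ^ 2) →
        (∀ j < n + 1, εU j ≤ α * r ^ j) →
        (∀ (j : ℕ) (b : Bond d (towerP L m (j + 1))), UlevOf L m (n + 1) U j b ∈ U1 𝔸) →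
        ∀ (hpos' : ∀ x : SiteL2K ℂ d (towerP L m (n + 1)) c₀ W, x ≠ 0 → 0 < RCLike.re ⟪x, laplacePrimeAk L m n φ η U a' (c₁ := c₁) x⟫_ℂ)
          (x : BondL2K ℂ d (towerP L m (n + 1)) c₀ W), x ≠ 0 →
          0 < RCLike.re ⟪x, laplaceAkPi L m n φ τ η U a' hpos' hL αU hα1 hU1 hreg (c₁ := c₁) a x⟫_ℂ := by
  obtain ⟨α₀, γ, hα₀, hγ, H⟩ := exists_laplaceAkPi_coercive_diagonal_closed (d := d) L hL φ hMφ hMφ' hφ hφ' ha ha' hr0 hr1 τ hτ hCτ hρw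
  refine ⟨α₀, hα₀, ?_⟩
  intro n η hηL c₀ c₁ _ _ hw hρ m _ U αU hα1 hU1 hreg εU hεU hUε α hα0 hαle hRS hUb hUη hpl hεg hUlev hpos' x hx
  have h := H n η hηL c₀ c₁ hw hρ m U αU hα1 hU1 hreg εU hεU hUε hα0 hαle hRS hUb hUη hpl hεg hUlev hpos' x
  have hx' : 0 < ‖x‖ := norm_pos_iff.2 hx
  have h2 : 0 < γ * (‖covCurlL2K ℂ c₀ ((η : ℂ))⁻¹ (adTransportW φ (fun _ : Bond d (towerP L m (n + 1)) => (1 : 𝔸ˣ))) x‖ ^ 2 +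
      ‖covDivL2K ℂ c₀ ((η : ℂ))⁻¹ (adTransportW φ fun _ : Bond d (towerP L m (n + 1)) => (1 : 𝔸ˣ)⁻¹) x‖ ^ 2 + ‖x‖ ^ 2) :=
    mul_pos hγ (add_pos_of_nonneg_of_pos (add_nonneg (sq_nonneg _) (sq_nonneg _)) (pow_pos hx' 2))
  linarith

end Literature.MathematicalPhysics.QuantumFieldTheory.Balaban1983to89.B9Thm311LaplaceAkPiPositiveDiagonal

end
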